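import Literature.MathematicalPhysics.QuantumFieldTheory.King1986.TopScalePiece
import Literature.MathematicalPhysics.QuantumFieldTheory.King1986.TorusCongr

/-!
# BalabanUVNodes ∕ N15 — THE KING-MODEL RUNG (PART Ϙ-a): TRANSLATION COVARIANCE OF KING's `A = 0` BLOCK-SPIN OPERATORS ON THE TORUS —
# `G^η_k = A₀⁻¹`, `C^η`, THE TOP PIECE `G^η_{(K)}`, THE MINIMISER `ℋ_k = a_kG^η_kQ_k^*`, `Δ^{(k)}` AND `(Δ^{(k)})⁻¹` ARE INVARIANT UNDER THE BLOCK
# TRANSLATIONS `x ↦ x + L^k·v` OF `T_η` PAIRED WITH `b ↦ b + v` OF `T^{(k)}`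
# (Track A, DAG node N15 = NE2; FAN-OUT v1.1 §N15 s3 «KING-MODEL RUNG … NE2's analogue DECIDED in the model»)

HONEST FRAMING.  Count-neutral (cell `pub-ymgap`, seat `pub-ymgap-dag-n15-e` g31; `--supports stmt-QuantumFields-27366 --as helper` = K3⁸
`SpineGivenEndpointR13SepCoPHV`).  TEMPLATE LITERATURE: C. King, *The U(1) Higgs model. I. The continuum limit*, Commun. Math. Phys. **102** (1986) 649–677
[King1986] — KING's OWN `A = 0` MODEL on finite tori with periodic boundary conditions (the setting of King's §4, p. 670 «(and A = 0, of course)»).  The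
operators are the tree's real matrices of `King1986.EffectiveLaplacianSymbol` ∕ `CovarianceSplitting` ∕ `TopScalePiece`: `lapF` (`c(−Δ) + m²`, (4.4)),
`blockProj = Q*Q`, `Qmat` (block mean (2.10)), `fineOp = A₀ = c(−Δ) + m² + aQ*Q`, `constrainedProp = N^d·A₀⁻¹ = G^η_k` ((2.13)), `(lapF)⁻¹ = C^η∕N^d`,
`topPiece = G^η_{(K)}` ((2.17)∕(4.44)), `minimiserMat = ℋ_k` ((2.15)), `effLaplacian = Δ^{(k)}` ((2.14)∕(4.5)) and its inverse (the unit-lattice block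
covariance).  NOT Bałaban's `G(U)` (whose kernels are COVARIANT under the simultaneous translation of the background `U`, not invariant — that is what the curved
case adds); NOT a node discharge (N15 is booked through n15-a's knit, untouched here); nothing continuum ∕ ℝ⁴ ∕ OS ∕ mass-gap ∕ Clay.  0 `sorry`; standard axioms.

THE PRINT.  King uses the translation invariance of the `A = 0` block-spin operators on the torus tacitly throughout §4 (every operator there is diagonalised
by plane waves, (4.1)–(4.5) p. 670: *«In terms of this representation we have … Δ^{(k)}(p′) = (a_k⁻¹ + Σ_l |u^η_k(p′ + l)|² Δ^η(p′ + l)⁻¹)⁻¹»* — a Fourier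
multiplier IS a translation-invariant operator) and in §3.2, p. 659: *«Clearly E₁ is represented by a sum of vacuum energy diagrams on T_η»* — the vacuum energy
counterterm is a CONSTANT times the volume precisely because a vacuum diagram pinned at a block does not depend on the block.  The tree's momentum-space files
(`EffectiveLaplacianSymbol`, `MinimizerFourier`, `TorusBlockForm.hat_of_transl`) prove the plane-wave FORMS; the position-space statement «the KERNELS are
invariant under block translations» — which is what the diagram calculus of parts Γ∕Α∕Β consumes — was not in the tree (this seat's g0 design note: «`Δ^{(K)}` as
a SITE layer dropped: needs translation invariance of `Q A₀⁻¹ Qᵀ`, not in tree»).  This file supplies it, hypothesis-free (no sign condition on `a, c, m²`: Mathlib's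
`Matrix.inv_submatrix_equiv` makes `T ↦ T⁻¹` commute with re-indexing along ANY permutation, invertible or not).

READING (declared; ours).  The coarse torus `T^{(k)} = Tor M` acts on itself by `b ↦ b + v` and on the fine torus `T_η = Tor (fine N M)` (`N = L^k` sites per block
side) by `x ↦ x + N·v`, `N·v = B5Block118.up N M v` (the b05 lineage's lift, `= corner` of `TorusBlockForm`); a block translation moves blocks to blocks
(`blockOf (x + N·v) = blockOf x + v`, §2), so the block mean is COVARIANT (`Q(b + v, x + N·v) = Q(b, x)`) and every operator assembled from `c(−Δ) + m²`, `Q`,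
`Qᵀ`, sums, scalar multiples, products and INVERSES inherits the covariance (§1: the generic calculus on `Tor`-indexed real matrices — products by re-indexing the
inner sum along `Equiv.addRight`, inverses by `Matrix.inv_submatrix_equiv`).

WHAT THIS FILE PROVES (kernel; 0 `def`).  §1 (generic, any tori): `submatrix_addRight_eq_iff`, `sum_transl`, ★ `inv_transl` (the inverse of a translation-
invariant matrix is translation invariant), `mul_transl` (covariant × covariant = covariant), `mulVec_transl`.  §2 (King's operators): `site_add_up`,
★ `blockOf_add_up`, `blockProj_transl`, `Qmat_transl`, `fineOp_transl`, ★ `fineOp_inv_transl`, ★★ **`constrainedProp_transl`** (`G^η_k(x + N·v, y + N·v) =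
G^η_k(x, y)`), `lapF_inv_transl` (`C^η` fully translation invariant), ★ `topPiece_transl` (`G^η_{(K)}`), ★★ **`minimiserMat_transl`** ∕ `minimiser_single_transl` ∕
★ `minimiser_transl` (`ℋ_k(x + N·v, b + v) = ℋ_k(x, b)`; `ℋ_k(φ∘τ_v) = (ℋ_kφ)∘τ_{N·v}`), ★★ **`effLaplacian_transl`** and ★★★ **`effLaplacian_inv_transl`**
(`Δ^{(k)}` and the block covariance `(Δ^{(k)})⁻¹` are translation invariant on `T^{(k)}`), `torCongr_up` (the lift does not see the spelling of the periods).

HONEST SCOPE.  (a) Periodic boundary conditions (a torus) and the flat block mean (2.10) only — King's §4 setting; with free boundary conditions (King's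
rectangular `Ω`, p. 670 «multiple reflection representations») translation invariance fails at the boundary and is not claimed.  (b) `A = 0`: for Bałaban's
covariant averages `Q(U)` the statement becomes covariance under `(U, x) ↦ (τ_v U, x + N·v)`, not typed here.  (c) Nothing here is an estimate; the consumers
(parts Ϙ-b∕c∕d: the rung's line kernels and legs, EXACT extensivity of vacuum diagrams, translation invariance of the continuum kernels) follow.
Locators: [King1986] (2.10)–(2.15) pp.652–653, (2.17) p.653, p.659 («E₁ … vacuum energy diagrams»), (4.1)–(4.5) p.670, (4.44) p.675.
-/

noncomputable section

open scoped BigOperators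
open Finset Matrix

namespace Summit.QuantumFields.YangMills.BalabanUVNodes.N15KingModelRung.Transl

open Literature.MathematicalPhysics.QuantumFieldTheory.Balaban1983to89.B5Prop11Plancherel (Tor fine unitVec)
open Literature.MathematicalPhysics.QuantumFieldTheory.Balaban1983to89 (B5Block118.up B5Block118.up_add B5Block118.iota)
open Literature.MathematicalPhysics.QuantumFieldTheory.King1986.Torus

variable {d : ℕ}

/-! ## §1 Generic: translation-invariant ∕ covariant real matrices indexed by finite tori -/

section Generic

variable {N₁ N₂ N₃ : Fin d → ℕ}

/-- Covariance `T(x + s, y + t) = T(x, y)` IS invariance under re-indexing along the translations `Equiv.addRight`. [folklore] -/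
theorem submatrix_addRight_eq_iff {α : Type*} (T : Matrix (Tor N₁) (Tor N₂) α) (s : Tor N₁) (t : Tor N₂) :
    T.submatrix (Equiv.addRight s) (Equiv.addRight t) = T ↔ ∀ x y, T (x + s) (y + t) = T x y := by
  rw [← Matrix.ext_iff]
  simp only [Matrix.submatrix_apply, Equiv.coe_addRight]

/-- Re-indexing a sum over the torus along a translation. [folklore] -/
theorem sum_transl [∀ μ, NeZero (N₁ μ)] {α : Type*} [AddCommMonoid α] (t : Tor N₁) (f : Tor N₁ → α) : ∑ y, f (y + t) = ∑ y, f y :=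
  Fintype.sum_equiv (Equiv.addRight t) _ _ fun _ => rfl

/-- ★ **THE INVERSE OF A TRANSLATION-INVARIANT MATRIX IS TRANSLATION INVARIANT** — for ANY real square matrix on a finite torus (no invertibility needed:
Mathlib's `Matrix.inv_submatrix_equiv`, the generalised inverse commutes with re-indexing along a permutation). [folklore] -/
theorem inv_transl [∀ μ, NeZero (N₁ μ)] {T : Matrix (Tor N₁) (Tor N₁) ℝ} {t : Tor N₁} (hT : ∀ x y, T (x + t) (y + t) = T x y) (x y : Tor N₁) :
    T⁻¹ (x + t) (y + t) = T⁻¹ x y := by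
  have h : T.submatrix (Equiv.addRight t) (Equiv.addRight t) = T := (submatrix_addRight_eq_iff T t t).2 hT
  have h2 : T⁻¹.submatrix (Equiv.addRight t) (Equiv.addRight t) = T⁻¹ := by
    rw [← Matrix.inv_submatrix_equiv, h]
  exact (submatrix_addRight_eq_iff _ t t).1 h2 x y

/-- **Covariant × covariant = covariant**: `A(x + s, y + t) = A(x, y)` and `B(y + t, z + u) = B(y, z)` give `(AB)(x + s, z + u) = (AB)(x, z)`. [folklore] -/
theorem mul_transl [∀ μ, NeZero (N₂ μ)] (A : Matrix (Tor N₁) (Tor N₂) ℝ) (B : Matrix (Tor N₂) (Tor N₃) ℝ) {s : Tor N₁} {t : Tor N₂} {u : Tor N₃}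
    (hA : ∀ x y, A (x + s) (y + t) = A x y) (hB : ∀ y z, B (y + t) (z + u) = B y z) (x : Tor N₁) (z : Tor N₃) :
    (A * B) (x + s) (z + u) = (A * B) x z := by
  simp only [Matrix.mul_apply]
  calc ∑ y, A (x + s) y * B y (z + u) = ∑ y, A (x + s) (y + t) * B (y + t) (z + u) :=
        (sum_transl t (fun y => A (x + s) y * B y (z + u))).symm
    _ = ∑ y, A x y * B y z := Finset.sum_congr rfl fun y _ => by rw [hA, hB]

/-- **Covariant operators intertwine translations**: `(T(f∘τ_t))(x) = (Tf)(x + s)`. [folklore] -/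
theorem mulVec_transl [∀ μ, NeZero (N₂ μ)] (T : Matrix (Tor N₁) (Tor N₂) ℝ) {s : Tor N₁} {t : Tor N₂} (hT : ∀ x y, T (x + s) (y + t) = T x y)
    (f : Tor N₂ → ℝ) (x : Tor N₁) :
    (T *ᵥ fun y => f (y + t)) x = (T *ᵥ f) (x + s) := by
  simp only [Matrix.mulVec, dotProduct]
  calc ∑ y, T x y * f (y + t) = ∑ y, T (x + s) (y + t) * f (y + t) := Finset.sum_congr rfl fun y _ => by rw [hT]
    _ = ∑ y, T (x + s) y * f y := sum_transl t (fun y => T (x + s) y * f y)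

/-- The transpose of a covariant matrix is covariant (with the translations exchanged). [folklore] -/
theorem transpose_transl (A : Matrix (Tor N₁) (Tor N₂) ℝ) {s : Tor N₁} {t : Tor N₂} (hA : ∀ x y, A (x + s) (y + t) = A x y)
    (y : Tor N₂) (x : Tor N₁) : Aᵀ (y + t) (x + s) = Aᵀ y x := by
  rw [Matrix.transpose_apply, Matrix.transpose_apply, hA]

end Generic

/-! ## §2 King's `A = 0` block-spin operators: block translations `x ↦ x + N·v`, `b ↦ b + v` -/

section King

variable (N : ℕ) [NeZero N] (M : Fin d → ℕ) [hM : ∀ μ, NeZero (M μ)]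

omit [NeZero N] in
/-- `(N·b + j) + N·v = N·(b + v) + j`. [cite: King1986, (2.10) p.653] -/
theorem site_add_up (b v : Tor M) (j : Fin d → Fin N) : site N M b j + B5Block118.up N M v = site N M (b + v) j := by
  rw [site_eq, site_eq, corner_eq_up, corner_eq_up, B5Block118.up_add]
  abel

/-- ★ **BLOCK TRANSLATIONS MOVE BLOCKS**: `B(x + N·v) = B(x) + v`. [cite: King1986, (2.10) p.653] -/
theorem blockOf_add_up (x : Tor (fine N M)) (v : Tor M) : blockOf N M (x + B5Block118.up N M v) = blockOf N M x + v := by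
  obtain ⟨⟨b, j⟩, rfl⟩ := (blockEquiv N M).surjective x
  rw [blockEquiv_apply, site_add_up, blockOf_site, blockOf_site]

/-- `Q*Q` is invariant under block translations. [cite: King1986, (2.10)–(2.13) p.653] -/
theorem blockProj_transl (x y : Tor (fine N M)) (v : Tor M) :
    blockProj N M (x + B5Block118.up N M v) (y + B5Block118.up N M v) = blockProj N M x y := by
  simp only [blockProj, blockOf_add_up, add_left_inj]

/-- **THE BLOCK MEAN IS COVARIANT**: `Q(b + v, x + N·v) = Q(b, x)`. [cite: King1986, (2.10) p.653] -/
theorem Qmat_transl (b v : Tor M) (x : Tor (fine N M)) :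
    Qmat N M (b + v) (x + B5Block118.up N M v) = Qmat N M b x := by
  simp only [Qmat, blockOf_add_up, add_left_inj]

/-- `A₀ = c(−Δ) + m² + aQ*Q` is invariant under block translations. [cite: King1986, (2.13) p.653, (4.4)–(4.5) p.670] -/
theorem fineOp_transl (a c m2 : ℝ) (x y : Tor (fine N M)) (v : Tor M) :
    fineOp N M a c m2 (x + B5Block118.up N M v) (y + B5Block118.up N M v) = fineOp N M a c m2 x y := by
  rw [fineOp, Matrix.add_apply, Matrix.add_apply, Matrix.smul_apply, Matrix.smul_apply, lapF_transl, blockProj_transl]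

/-- ★ `A₀⁻¹` is invariant under block translations. [cite: King1986, (2.13) p.653, (4.5) p.670] -/
theorem fineOp_inv_transl (a c m2 : ℝ) (x y : Tor (fine N M)) (v : Tor M) :
    (fineOp N M a c m2)⁻¹ (x + B5Block118.up N M v) (y + B5Block118.up N M v) = (fineOp N M a c m2)⁻¹ x y :=
  inv_transl (fun x' y' => fineOp_transl N M a c m2 x' y' v) x y

/-- ★★ **KING's BLOCK-CONSTRAINED PROPAGATOR `G^η_k = N^d·A₀⁻¹` IS INVARIANT UNDER BLOCK TRANSLATIONS**: `G^η_k(x + N·v, y + N·v) = G^η_k(x, y)` — no hypothesis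
on `a, c, m²`. [cite: King1986, (2.13) p.653, (4.44) p.675] -/
theorem constrainedProp_transl (a c m2 : ℝ) (x y : Tor (fine N M)) (v : Tor M) :
    constrainedProp N M a c m2 (x + B5Block118.up N M v) (y + B5Block118.up N M v) = constrainedProp N M a c m2 x y := by
  rw [constrainedProp, Matrix.smul_apply, Matrix.smul_apply, fineOp_inv_transl]

omit [NeZero N] hM in
/-- `(c(−Δ) + m²)⁻¹` — King's `C^η∕N^d` — is invariant under EVERY translation of the torus. [cite: King1986, (2.17) p.653, (4.4) p.670] -/
theorem lapF_inv_transl (K : Fin d → ℕ) [∀ μ, NeZero (K μ)] (c m2 : ℝ) (x y t : Tor K) :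
    (lapF K c m2)⁻¹ (x + t) (y + t) = (lapF K c m2)⁻¹ x y :=
  inv_transl (fun x' y' => lapF_transl K c m2 x' y' t) x y

/-- ★ **THE TOP-SCALE PIECE `G^η_{(K)} = C^η − G^η_K` IS INVARIANT UNDER BLOCK TRANSLATIONS.** [cite: King1986, (2.17) p.653, (4.44) p.675] -/
theorem topPiece_transl (a c m2 : ℝ) (x y : Tor (fine N M)) (v : Tor M) :
    topPiece N M a c m2 (x + B5Block118.up N M v) (y + B5Block118.up N M v) = topPiece N M a c m2 x y := by
  rw [topPiece, Matrix.smul_apply, Matrix.smul_apply, Matrix.sub_apply, Matrix.sub_apply, lapF_inv_transl, fineOp_inv_transl]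

/-- ★★ **THE MINIMISER KERNEL `ℋ_k = a_kG^η_kQ_k^*` IS COVARIANT**: `ℋ_k(x + N·v, b + v) = ℋ_k(x, b)`. [cite: King1986, (2.15) p.653] -/
theorem minimiserMat_transl (a c m2 : ℝ) (x : Tor (fine N M)) (b v : Tor M) :
    minimiserMat N M a c m2 (x + B5Block118.up N M v) (b + v) = minimiserMat N M a c m2 x b := by
  rw [minimiserMat, Matrix.smul_apply, Matrix.smul_apply]
  congr 1
  exact mul_transl _ _ (fun x' y' => fineOp_inv_transl N M a c m2 x' y' v)
    (fun y' b' => transpose_transl (Qmat N M) (fun b'' x'' => Qmat_transl N M b'' v x'') y' b') x b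

/-- `ℋ_k(x + N·v, b + v) = ℋ_k(x, b)`, in the `minimiser (δ_b)` spelling the rung's files use (`kingH`). [cite: King1986, (2.15) p.653] -/
theorem minimiser_single_transl (a c m2 : ℝ) (x : Tor (fine N M)) (b v : Tor M) :
    minimiser N M a c m2 (Pi.single (b + v) 1) (x + B5Block118.up N M v) = minimiser N M a c m2 (Pi.single b 1) x := by
  rw [← minimiserMat_apply, ← minimiserMat_apply, minimiserMat_transl]

/-- ★ **THE MINIMISER INTERTWINES TRANSLATIONS**: `ℋ_k(φ ∘ τ_v)(x) = (ℋ_kφ)(x + N·v)`. [cite: King1986, (2.15) p.653] -/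
theorem minimiser_transl (a c m2 : ℝ) (φ : Tor M → ℝ) (v : Tor M) (x : Tor (fine N M)) :
    minimiser N M a c m2 (fun b => φ (b + v)) x = minimiser N M a c m2 φ (x + B5Block118.up N M v) := by
  rw [minimiser_eq_minimiserMat_mulVec, minimiser_eq_minimiserMat_mulVec]
  exact mulVec_transl _ (fun x' b' => minimiserMat_transl N M a c m2 x' b' v) φ x

/-- ★★ **KING's EFFECTIVE LAPLACIAN `Δ^{(k)} = a − a²Q_kG^η_kQ_k^*` IS TRANSLATION INVARIANT ON `T^{(k)}`.** [cite: King1986, (2.14) p.653, (4.5) p.670] -/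
theorem effLaplacian_transl (a c m2 : ℝ) (b b' v : Tor M) :
    effLaplacian N M a c m2 (b + v) (b' + v) = effLaplacian N M a c m2 b b' := by
  rw [effLaplacian, Matrix.sub_apply, Matrix.sub_apply, Matrix.smul_apply, Matrix.smul_apply, Matrix.smul_apply, Matrix.smul_apply,
    Matrix.one_apply, Matrix.one_apply]
  simp only [add_left_inj]
  congr 2
  refine mul_transl _ _ (fun b₁ y₁ => ?_) (fun y' b'' => transpose_transl (Qmat N M) (fun b₃ x₃ => Qmat_transl N M b₃ v x₃) y' b'') b b'
  exact mul_transl _ _ (fun b₃ x₃ => Qmat_transl N M b₃ v x₃) (fun x' y' => fineOp_inv_transl N M a c m2 x' y' v) b₁ y₁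

/-- ★★★ **THE BLOCK COVARIANCE `(Δ^{(k)})⁻¹` IS TRANSLATION INVARIANT ON `T^{(k)}`** (no hypothesis on `a, c, m²`). [cite: King1986, (2.14) p.653, (4.5) p.670,
(4.39)–(4.41) pp.674–675] -/
theorem effLaplacian_inv_transl (a c m2 : ℝ) (b b' v : Tor M) :
    (effLaplacian N M a c m2)⁻¹ (b + v) (b' + v) = (effLaplacian N M a c m2)⁻¹ b b' :=
  inv_transl (fun b₁ b₂ => effLaplacian_transl N M a c m2 b₁ b₂ v) b b'

omit [NeZero N] hM in
/-- The lift `v ↦ N·v` does not see the spelling of the fine periods (`torCongr` along `fine N M = fine N′ M` for `N = N′`). [cite: King1986, (2.20) p.654] -/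
theorem torCongr_up {N' : ℕ} (h : ∀ μ, fine N M μ = fine N' M μ) (hN : N = N') (v : Tor M) :
    torCongr h (B5Block118.up N M v) = B5Block118.up N' M v := by
  subst hN
  exact torCongr_refl h _

omit [NeZero N] hM in
/-- … hence `torCongr` carries the block translation by `v` to the block translation by `v`. [cite: King1986, (2.20) p.654] -/
theorem torCongr_add_up {N' : ℕ} (h : ∀ μ, fine N M μ = fine N' M μ) (hN : N = N') (x : Tor (fine N M)) (v : Tor M) :
    torCongr h (x + B5Block118.up N M v) = torCongr h x + B5Block118.up N' M v := by
  rw [torCongr_add, torCongr_up N M h hN]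

end King

end Summit.QuantumFields.YangMills.BalabanUVNodes.N15KingModelRung.Transl

end
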